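import Literature.NumberTheory.NumberFields.CoinvariantGenusBound
import Literature.NumberTheory.NumberFields.ClassGroupNormSurjective
import Literature.NumberTheory.IwasawaTheory.ClassGroupPRankCoinvariantCriterion
import Literature.NumberTheory.IwasawaTheory.ZpExtensionNormKernelLayerPair
import Literature.NumberTheory.IwasawaTheory.ZpExtensionLayerTotallyRamifiedPrime
import Literature.NumberTheory.IwasawaTheory.ClassicalMuInvariantOnePrimeProofs
import Literature.NumberTheory.IwasawaTheory.ClassGroupPRankSmallRankCriterion
import Literature.NumberTheory.IwasawaTheory.ClassicalLambdaLeStableRank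
import HarnessLib

/-!
# Door L12 made RANK-EXPLICIT: the genus bound at ONE pair of layers `(K_{n₀+1}, K_{n₀+2})` with parameter `c ≤ p − 1` gives
# `rank_p Cl(K_{n₀+k}) ≤ c` for EVERY `k` (not only «bounded ranks and `μ = 0`»)

Topic `NumberTheory/IwasawaTheory` (namespace = path).  THEOREM-ONLY file (no definition, no named fact, no instance, no `sorry`), written by the prover seat
`bsd-line-att-p3` g28 (cell `bsd-f1-sign2`; `--supports` stmt-BirchSwinnertonDyer-22298; closes nothing; no class group is computed here).  Sequel of
`ClassGroupCoinvariantGenusCriterion.lean` (cell bsd-2adic k4-w2 GEN 14: `classicalMuVanishes_of_genus_bound_layer_succ_succ`, `…_of_rank_add_le_layer_succ_succ`,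
conclusion `(∃ B, ∀ m, rank_p Cl(K_m) ≤ B) ∧ ClassicalMuVanishes κ`) and of `ClassGroupPRankCoinvariantCriterion.lean` (cell bsd-potss k9-c4 g26:
`classGroupPRank_le_of_coinvariant_index_le`, conclusion `rank_p Cl(K_{n+k}) ≤ c ∀ k`).  The door's own proof passes through the coinvariant index bound `≤ p^c`,
so the sharper conclusion of the coinvariant criterion is available at no cost; this file records it (self-contained: it imports the door's bricks, not the door
file, and re-proves the norm surjectivity step privately):

* `classGroupPRank_zero_eq` — dictionary `r_0 = ord_p [Cl(K) : Cl(K)^p]` (a datum at Fukuda index `0` is about `Cl(K)` itself);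
* ★ `classGroupPRank_le_of_genus_bound_layer_succ_succ` — `TotallyRamifiedFrom κ n₀`, `c ≤ p − 1`,
  `[Cl(M) : Cl(M)^p] · ∏_𝔓 e_𝔓(L/M) ≤ p^c · p · [E_M : E_M ∩ N_{L/M} Lˣ]` at `(M, L) = (K_{n₀+1}, K_{n₀+2})` ⟹ **`rank_p Cl(K_{n₀+k}) ≤ c` for every `k`**
  (in particular `rank_p Cl(K_{n₀}) ≤ c`, `rank_p Cl(M) ≤ c`, `rank_p Cl(L) ≤ c`);
* ★ `classGroupPRank_le_of_rank_add_le_layer_succ_succ` — rank form: `[Cl(M):Cl(M)^p] ≤ p^k`, `p^r ∣ [E_M : E_M ∩ N Lˣ]`, `t` ramified primes, `k + t ≤ c + 1 + r`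
  ⟹ `rank_p Cl(K_{n₀+j}) ≤ c` for every `j`.  At `p = 2` (`c ≤ 1`): the door can only fire on towers whose `2`-class ranks are `≤ 1` from layer `n₀` on.
* `classicalLambda_le_of_genus_bound_layer_succ_succ` / `classicalLambda_le_of_rank_add_le_layer_succ_succ` — the same doors bound **`λ ≤ c`**
  (`ClassicalLambdaLeStableRank.classicalLambda_le_of_forall_classGroupPRank_le`, this seat); `classicalLambda_le_of_lt_pow_sub_one` — door L10
  (`ClassGroupPRankSmallRankCriterion`, `rank_p Cl(K_{n+j}) < p^j − 1`) bounds **`λ ≤ rank_p Cl(K_{n+j})`**.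

USE (cell bsd-f1-sign2, crux C2): necessary conditions for the door — a tower with `rank_p Cl(K_m) ≥ c + 1` at some `m ≥ n₀` (e.g. by genus theory, many
ramified primes) is outside its range; see `Summits/…/AlignedTransportAtTwoMainConjectureOfRankZeroBSDAtTwoSexticRankCertificate.lean` (the `S₃`-sextic `ℚ(W[2])`).
References: [Washington1997] §13.3 Lemma 13.18, Prop. 13.22–13.23; [Fukuda1994] Thm. 1 (proof, p. 264); [Lang1990] Ch. 13 §4 Lemma 4.1; [Gras2003] IV.4;
[NeukirchANT1999] Ch. I §9 (9.6).
-/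

set_option autoImplicit false

noncomputable section

open scoped NumberField
open NumberField IsDedekindDomain Field

namespace Literature.NumberTheory.IwasawaTheory

open Literature.NumberTheory.EllipticCurves Literature.NumberTheory.NumberFields
  Literature.NumberTheory.NumberFields.AmbiguousClass
  Literature.NumberTheory.GaloisRepresentations Literature.NumberTheory.GaloisRepresentations.Herbrand
  Literature.NumberTheory.GaloisRepresentations.MinkowskiUnit
  Literature.NumberTheory.GaloisRepresentations.CyclicNormIndex

variable {K : Type} [Field K] [NumberField K] {p : ℕ} [hp : Fact p.Prime]

/-- **Dictionary, bottom layer: `r_0 = rank_p Cl(K)`** — `classGroupPRank κ 0` is the `p`-adic valuation of `[Cl(K) : Cl(K)^p]` (`K_0 = K`,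
`ZpExtension.layer_zero`; transport of `Cl` along `K_0 ≃ K`), so a rank datum or certificate read at Fukuda index `0` is a statement about `Cl(K)` itself.
[cite: Washington1997, §13.1] [cite: Fukuda1994, p. 264 (definition of `rank(M)`)] -/
theorem classGroupPRank_zero_eq (κ : ZpExtension K p) :
    classGroupPRank κ 0 = padicValNat p ((powMonoidHom p : ClassGroup (𝓞 K) →* ClassGroup (𝓞 K)).range.index) := by
  haveI : FiniteDimensional K (κ.layer 0) := κ.finiteDimensional_layer_holds 0
  haveI : NumberField (κ.layer 0) := NumberField.of_module_finite K (κ.layer 0)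
  have e : (κ.layer 0) ≃ₐ[K] K := (IntermediateField.equivOfEq κ.layer_zero).trans (IntermediateField.botEquiv K _)
  set φ : ClassGroup (𝓞 (κ.layer 0)) ≃* ClassGroup (𝓞 K) := ClassGroup.mulEquiv (RingOfIntegers.mapRingEquiv e.toRingEquiv) with hφ
  have hmap : ((powMonoidHom p : ClassGroup (𝓞 (κ.layer 0)) →* ClassGroup (𝓞 (κ.layer 0))).range).map (φ : _ →* ClassGroup (𝓞 K)) =
      (powMonoidHom p : ClassGroup (𝓞 K) →* ClassGroup (𝓞 K)).range := by
    ext x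
    constructor
    · rintro ⟨y, ⟨z, rfl⟩, rfl⟩
      exact ⟨φ z, by simp [map_pow]⟩
    · rintro ⟨z, rfl⟩
      exact ⟨(φ.symm z) ^ p, ⟨φ.symm z, rfl⟩, by simp [map_pow]⟩
  rw [classGroupPRank_def, ← Subgroup.index_eq_card, ← hmap, Subgroup.index_map_equiv]

/-- `N : Cl(K_{n₀+2}) → Cl(K_{n₀+1})` is onto above the Fukuda index (re-proved from the bricks; the door file's version is
`ClassGroupCoinvariantGenusCriterion.classGroupNorm_layer_succ_succ_surjective`): a prime of `K_{n₀+2}` totally ramified over `K_{n₀+1}` makes the norm onto.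
[cite: Washington1997, §13.1 Lemma 13.3 and Thm. 10.1] [cite: NeukirchANT1999, Ch. I §9 Prop. (9.6)] -/
private theorem classGroupNorm_layer_succ_succ_surjective' (κ : ZpExtension K p) {n₀ : ℕ} (hκ : TotallyRamifiedFrom κ n₀)
    [NumberField (κ.layer (n₀ + 1))] [NumberField (κ.layer (n₀ + (1 + 1)))] :
    letI : Algebra (κ.layer (n₀ + 1)) (κ.layer (n₀ + (1 + 1))) :=
      (IntermediateField.inclusion (κ.layer_mono (by omega))).toRingHom.toAlgebra
    Function.Surjective (classGroupNorm (κ.layer (n₀ + 1)) (κ.layer (n₀ + (1 + 1)))) := by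
  classical
  set M := κ.layer (n₀ + 1)
  set L := κ.layer (n₀ + (1 + 1))
  have hML : κ.layer (n₀ + 1) ≤ κ.layer (n₀ + (1 + 1)) := κ.layer_mono (by omega)
  letI : Algebra M L := (IntermediateField.inclusion hML).toRingHom.toAlgebra
  haveI : IsScalarTower K M L := IsScalarTower.of_algebraMap_eq fun x => ((IntermediateField.inclusion hML).commutes x).symm
  haveI : FiniteDimensional K M := κ.finiteDimensional_layer_holds _
  haveI : FiniteDimensional K L := κ.finiteDimensional_layer_holds _
  haveI : IsGalois K L := κ.isGalois_layer_holds _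
  haveI : FiniteDimensional M L := Module.Finite.of_restrictScalars_finite K M L
  haveI : IsGalois M L := isGalois_layer_layer κ
  obtain ⟨Q, hQmax, hQ⟩ := κ.exists_isMaximal_forall_mem_inertia hκ (n := n₀ + 1) (m := n₀ + (1 + 1)) (by omega) (by omega) (by omega)
  haveI := hQmax
  have htop : Q.inertia (L ≃ₐ[M] L) = ⊤ := by
    refine top_le_iff.mp fun τ _ => ?_
    have hK : τ.restrictScalars K ∈ Q.inertia (L ≃ₐ[K] L) := by
      refine hQ (τ.restrictScalars K) fun x hx => ?_
      have hx' : x = algebraMap M L ⟨(x : AlgebraicClosure K), hx⟩ := Subtype.ext rfl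
      rw [AlgEquiv.restrictScalars_apply, hx', AlgEquiv.commutes]
    intro x
    have h := hK x
    have heq : τ.restrictScalars K • x = τ • x := Subtype.ext rfl
    rwa [heq] at h
  haveI : (Q.under (𝓞 M)).IsMaximal := Ideal.IsMaximal.under (𝓞 M) Q
  have hcard := Ideal.card_inertia_eq_ramificationIdxIn (G := L ≃ₐ[M] L) (Q.under (𝓞 M)) Q
  rw [htop, Subgroup.card_top, Nat.card_eq_fintype_card, ← Nat.card_eq_fintype_card, IsGalois.card_aut_eq_finrank,
    Ideal.ramificationIdxIn_eq_ramificationIdx (Q.under (𝓞 M)) Q (L ≃ₐ[M] L)] at hcard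
  exact classGroupNorm_surjective_of_ramificationIdx_eq_finrank M L Q hcard.symm

/-- ★ **Door L12, rank-explicit.**  `κ` a `ℤ_p`-extension of the number field `K` with `TotallyRamifiedFrom κ n₀`; `M = K_{n₀+1} ⊆ L = K_{n₀+2}` (inclusion algebra
structure); `c ≤ p − 1`.  IF **`[Cl(M) : Cl(M)^p] · ∏_𝔓 e_𝔓(L/M) ≤ p^c · p · [E_M : E_M ∩ N_{L/M} Lˣ]`** THEN **`rank_p Cl(K_{n₀+k}) ≤ c` for every `k`**.  Proof: exactly as
`classicalMuVanishes_of_genus_bound_layer_succ_succ` — `Gal(L/M)` cyclic of order `p` generated by `σ`, unramified at infinity, norm onto; the genus bound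
`AmbiguousClass.index_pow_sup_range_mul_le_genus` gives `[Cl(L) : Cl(L)^p·I_σ] · p · [E:E∩N] ≤ [Cl(M):Cl(M)^p] · ∏e ≤ p^c · p · [E:E∩N]`, i.e. the coinvariant index is
`≤ p^c` — and then the coinvariant criterion `classGroupPRank_le_of_coinvariant_index_le` (`i = 1`, `c < p`) bounds EVERY rank by `c`.
[cite: Washington1997, §13.3 Lemma 13.18 and Prop. 13.22–13.23] [cite: Fukuda1994, Thm. 1 (proof, p. 264)] [cite: Lang1990, Ch. 13 §4, Lemma 4.1 (PDF p. 203)]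
[cite: Gras2003, IV.4] -/
theorem classGroupPRank_le_of_genus_bound_layer_succ_succ (κ : ZpExtension K p) {n₀ : ℕ} (hκ : TotallyRamifiedFrom κ n₀)
    [NumberField (κ.layer (n₀ + 1))] [NumberField (κ.layer (n₀ + (1 + 1)))] {c : ℕ} (hc : c ≤ p - 1)
    (hgen : letI : Algebra (κ.layer (n₀ + 1)) (κ.layer (n₀ + (1 + 1))) :=
        (IntermediateField.inclusion (κ.layer_mono (by omega))).toRingHom.toAlgebra
      (powMonoidHom p : ClassGroup (𝓞 (κ.layer (n₀ + 1))) →* ClassGroup (𝓞 (κ.layer (n₀ + 1)))).range.index *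
          (∏ᶠ v : HeightOneSpectrum (𝓞 (κ.layer (n₀ + 1))), v.asIdeal.ramificationIdxIn (𝓞 (κ.layer (n₀ + (1 + 1))))) ≤
        p ^ c * p * (unitsE (κ.layer (n₀ + (1 + 1))) ⊓ (⊤ : Subgroup (κ.layer (n₀ + (1 + 1)))ˣ).map
            (Herbrand.norm ((κ.layer (n₀ + (1 + 1))) ≃ₐ[κ.layer (n₀ + 1)] (κ.layer (n₀ + (1 + 1)))))).relIndex
          (unitsE (κ.layer (n₀ + (1 + 1))) ⊓ (unitsIncl (κ.layer (n₀ + 1)) (κ.layer (n₀ + (1 + 1)))).range))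
    (k : ℕ) : classGroupPRank κ (n₀ + k) ≤ c := by
  classical
  set M := κ.layer (n₀ + 1)
  set L := κ.layer (n₀ + (1 + 1))
  have hML : κ.layer (n₀ + 1) ≤ κ.layer (n₀ + (1 + 1)) := κ.layer_mono (by omega)
  letI : Algebra M L := (IntermediateField.inclusion hML).toRingHom.toAlgebra
  haveI : IsScalarTower K M L := IsScalarTower.of_algebraMap_eq fun x => ((IntermediateField.inclusion hML).commutes x).symm
  haveI : FiniteDimensional K M := κ.finiteDimensional_layer_holds _
  haveI : FiniteDimensional K L := κ.finiteDimensional_layer_holds _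
  haveI : IsGalois K L := κ.isGalois_layer_holds _
  haveI : FiniteDimensional M L := Module.Finite.of_restrictScalars_finite K M L
  haveI : IsGalois M L := isGalois_layer_layer κ
  haveI : IsUnramifiedAtInfinitePlaces K L := κ.isUnramifiedAtInfinitePlaces_layer _
  haveI : IsUnramifiedAtInfinitePlaces M L := IsUnramifiedAtInfinitePlaces.top K M L
  -- `Gal(L/M)` cyclic of order `p`
  haveI : IsCyclic (L ≃ₐ[M] L) := isCyclic_aut_layer_layer' κ
  obtain ⟨σ, hσ⟩ := IsCyclic.exists_generator (α := L ≃ₐ[M] L)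
  have hdeg : Module.finrank M L = p := by
    rw [finrank_layer_layer κ (show n₀ + 1 ≤ n₀ + (1 + 1) by omega)]
    simp
  have hN := classGroupNorm_layer_succ_succ_surjective' κ hκ
  -- genus bound for the generator, unramified at infinity: `X · p · U ≤ Y · ∏e`
  have hgenus := index_pow_sup_range_mul_le_genus hσ hN p
  rw [archFactor_eq_one, mul_one, hdeg] at hgenus
  set X := ((powMonoidHom p : ClassGroup (𝓞 L) →* ClassGroup (𝓞 L)).range ⊔
      ((ClassGroup.mulEquiv (intAut σ)).toMonoidHom / MonoidHom.id (ClassGroup (𝓞 L))).range).index with hX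
  set U := (unitsE L ⊓ (⊤ : Subgroup Lˣ).map (Herbrand.norm (L ≃ₐ[M] L))).relIndex (unitsE L ⊓ (unitsIncl M L).range) with hU
  have hU0 : 0 < U := Nat.pos_of_ne_zero (relIndex_unitsNorm_ne_zero hσ).1
  have hXle : X ≤ p ^ c := by
    have h1 : X * p * U ≤ p ^ c * p * U := le_trans hgenus hgen
    have h2 : X * (p * U) ≤ p ^ c * (p * U) := by simpa [mul_assoc] using h1
    exact Nat.le_of_mul_le_mul_right h2 (Nat.mul_pos hp.out.pos hU0)
  -- the subgroup of the coinvariant criterion contains `Cl(L)^p ⊔ I_σ`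
  have hco : ((powMonoidHom p : ClassGroup (𝓞 L) →* ClassGroup (𝓞 L)).range ⊔
      Subgroup.closure {x | ∃ (τ : L ≃ₐ[K] L)
        (_ : ∀ y : L, ((y : L) : AlgebraicClosure K) ∈ κ.layer (n₀ + 1) → τ y = y)
        (x' : ClassGroup (𝓞 L)), x = ClassGroup.mulEquiv (AmbiguousClass.intAut τ) x' * x'⁻¹}).index ≤ p ^ c := by
    refine le_trans (Subgroup.index_antitone (sup_le_sup_left ?_ _)) hXle
    rintro x ⟨y, rfl⟩
    refine Subgroup.subset_closure ⟨σ.restrictScalars K, fun z hz => ?_, y, ?_⟩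
    · have hz' : z = algebraMap M L ⟨(z : AlgebraicClosure K), hz⟩ := Subtype.ext rfl
      rw [AlgEquiv.restrictScalars_apply, hz', AlgEquiv.commutes]
    · rw [MonoidHom.div_apply, MonoidHom.id_apply, div_eq_mul_inv]
      rfl
  have hp2 : 2 ≤ p := hp.out.two_le
  have hc' : c < p ^ 1 := by rw [pow_one]; omega
  exact classGroupPRank_le_of_coinvariant_index_le κ hκ le_rfl hc' hco k

/-- ★ **Door L12, rank form, rank-explicit**: `TotallyRamifiedFrom κ n₀`, `c ≤ p − 1`, at the pair `M = K_{n₀+1} ⊆ L = K_{n₀+2}`: `t` primes of `M` ramified in `L`,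
`[Cl(M) : Cl(M)^p] ≤ p^k`, `p^r ∣ [E_M : E_M ∩ N Lˣ]` and **`k + t ≤ c + 1 + r`** ⟹ **`rank_p Cl(K_{n₀+j}) ≤ c` for every `j`**.  (At `p = 2`, `c = 1`:
`rank₂ Cl(K_{n₀+1}) + t ≤ 2 + r` ⟹ all `rank₂ Cl(K_{n₀+j}) ≤ 1`.) [cite: Washington1997, §13.3 Prop. 13.23] [cite: Lang1990, Ch. 13 §4, Lemma 4.1] [cite: Gras2003, IV.4] -/
theorem classGroupPRank_le_of_rank_add_le_layer_succ_succ (κ : ZpExtension K p) {n₀ : ℕ} (hκ : TotallyRamifiedFrom κ n₀)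
    [NumberField (κ.layer (n₀ + 1))] [NumberField (κ.layer (n₀ + (1 + 1)))] {c k r : ℕ} (hc : c ≤ p - 1)
    (hk : (powMonoidHom p : ClassGroup (𝓞 (κ.layer (n₀ + 1))) →* ClassGroup (𝓞 (κ.layer (n₀ + 1)))).range.index ≤ p ^ k)
    (hr : letI : Algebra (κ.layer (n₀ + 1)) (κ.layer (n₀ + (1 + 1))) :=
        (IntermediateField.inclusion (κ.layer_mono (by omega))).toRingHom.toAlgebra
      p ^ r ∣ (unitsE (κ.layer (n₀ + (1 + 1))) ⊓ (⊤ : Subgroup (κ.layer (n₀ + (1 + 1)))ˣ).map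
            (Herbrand.norm ((κ.layer (n₀ + (1 + 1))) ≃ₐ[κ.layer (n₀ + 1)] (κ.layer (n₀ + (1 + 1)))))).relIndex
          (unitsE (κ.layer (n₀ + (1 + 1))) ⊓ (unitsIncl (κ.layer (n₀ + 1)) (κ.layer (n₀ + (1 + 1)))).range))
    (ht : letI : Algebra (κ.layer (n₀ + 1)) (κ.layer (n₀ + (1 + 1))) :=
        (IntermediateField.inclusion (κ.layer_mono (by omega))).toRingHom.toAlgebra
      k + {v : HeightOneSpectrum (𝓞 (κ.layer (n₀ + 1))) |
        v.asIdeal.ramificationIdxIn (𝓞 (κ.layer (n₀ + (1 + 1)))) ≠ 1}.ncard ≤ c + 1 + r)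
    (j : ℕ) : classGroupPRank κ (n₀ + j) ≤ c := by
  classical
  set M := κ.layer (n₀ + 1)
  set L := κ.layer (n₀ + (1 + 1))
  have hML : κ.layer (n₀ + 1) ≤ κ.layer (n₀ + (1 + 1)) := κ.layer_mono (by omega)
  letI : Algebra M L := (IntermediateField.inclusion hML).toRingHom.toAlgebra
  haveI : IsScalarTower K M L := IsScalarTower.of_algebraMap_eq fun x => ((IntermediateField.inclusion hML).commutes x).symm
  haveI : FiniteDimensional K M := κ.finiteDimensional_layer_holds _
  haveI : FiniteDimensional K L := κ.finiteDimensional_layer_holds _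
  haveI : IsGalois K L := κ.isGalois_layer_holds _
  haveI : FiniteDimensional M L := Module.Finite.of_restrictScalars_finite K M L
  haveI : IsGalois M L := isGalois_layer_layer κ
  have hdeg : Module.finrank M L = p := by
    rw [finrank_layer_layer κ (show n₀ + 1 ≤ n₀ + (1 + 1) by omega)]
    simp
  refine classGroupPRank_le_of_genus_bound_layer_succ_succ κ hκ hc ?_ j
  rw [finprod_ramificationIdxIn_eq_pow_of_prime hp.out hdeg]
  set t := {v : HeightOneSpectrum (𝓞 M) | v.asIdeal.ramificationIdxIn (𝓞 L) ≠ 1}.ncard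
  set U := (unitsE L ⊓ (⊤ : Subgroup Lˣ).map (Herbrand.norm (L ≃ₐ[M] L))).relIndex (unitsE L ⊓ (unitsIncl M L).range)
  obtain ⟨m, hm⟩ := hr
  haveI : IsCyclic (L ≃ₐ[M] L) := isCyclic_aut_layer_layer' κ
  obtain ⟨σ, hσ⟩ := IsCyclic.exists_generator (α := L ≃ₐ[M] L)
  have hU0 : U ≠ 0 := (relIndex_unitsNorm_ne_zero hσ).1
  have hm0 : 0 < m := by
    rcases Nat.eq_zero_or_pos m with h0 | h0
    · exact absurd (by rw [hm, h0, mul_zero]) hU0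
    · exact h0
  have hp1 : 1 ≤ p := hp.out.pos
  calc (powMonoidHom p : ClassGroup (𝓞 M) →* ClassGroup (𝓞 M)).range.index * p ^ t
      ≤ p ^ k * p ^ t := Nat.mul_le_mul_right _ hk
    _ = p ^ (k + t) := by rw [pow_add]
    _ ≤ p ^ (c + 1 + r) := Nat.pow_le_pow_right hp1 ht
    _ = p ^ c * p * p ^ r := by rw [pow_add, pow_add, pow_one]
    _ ≤ p ^ c * p * p ^ r * m := Nat.le_mul_of_pos_right _ hm0
    _ = p ^ c * p * U := by rw [hm]; ring

/-- **Necessary condition for door L12 (rank form)**: if some layer `K_{n₀+j}` has `rank_p Cl(K_{n₀+j}) ≥ c + 1`, the door's numerical hypothesis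
`k + t ≤ c + 1 + r` (with `[Cl(M):Cl(M)^p] ≤ p^k`, `p^r ∣ [E_M : E_M ∩ N Lˣ]`) FAILS at the pair `(K_{n₀+1}, K_{n₀+2})`.
[cite: Washington1997, §13.3 Prop. 13.23] [cite: Gras2003, IV.4] -/
theorem not_rank_add_le_of_lt_classGroupPRank (κ : ZpExtension K p) {n₀ : ℕ} (hκ : TotallyRamifiedFrom κ n₀)
    [NumberField (κ.layer (n₀ + 1))] [NumberField (κ.layer (n₀ + (1 + 1)))] {c k r : ℕ} (hc : c ≤ p - 1)
    (hk : (powMonoidHom p : ClassGroup (𝓞 (κ.layer (n₀ + 1))) →* ClassGroup (𝓞 (κ.layer (n₀ + 1)))).range.index ≤ p ^ k)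
    (hr : letI : Algebra (κ.layer (n₀ + 1)) (κ.layer (n₀ + (1 + 1))) :=
        (IntermediateField.inclusion (κ.layer_mono (by omega))).toRingHom.toAlgebra
      p ^ r ∣ (unitsE (κ.layer (n₀ + (1 + 1))) ⊓ (⊤ : Subgroup (κ.layer (n₀ + (1 + 1)))ˣ).map
            (Herbrand.norm ((κ.layer (n₀ + (1 + 1))) ≃ₐ[κ.layer (n₀ + 1)] (κ.layer (n₀ + (1 + 1)))))).relIndex
          (unitsE (κ.layer (n₀ + (1 + 1))) ⊓ (unitsIncl (κ.layer (n₀ + 1)) (κ.layer (n₀ + (1 + 1)))).range))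
    {j : ℕ} (hj : c < classGroupPRank κ (n₀ + j)) :
    letI : Algebra (κ.layer (n₀ + 1)) (κ.layer (n₀ + (1 + 1))) :=
        (IntermediateField.inclusion (κ.layer_mono (by omega))).toRingHom.toAlgebra
    ¬ k + {v : HeightOneSpectrum (𝓞 (κ.layer (n₀ + 1))) |
        v.asIdeal.ramificationIdxIn (𝓞 (κ.layer (n₀ + (1 + 1)))) ≠ 1}.ncard ≤ c + 1 + r := fun ht =>
  absurd (classGroupPRank_le_of_rank_add_le_layer_succ_succ κ hκ hc hk hr ht j) (not_le.mpr hj)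

/-! ## The `λ`-readings of doors L12 and L10 -/

/-- **Door L12 bounds `λ`: `λ ≤ c`** (genus-bound form). [cite: Washington1997, §13.3 Prop. 13.23 and Thm. 13.13] [cite: Fukuda1994, Thm. 1 (proof, p. 264)] -/
theorem classicalLambda_le_of_genus_bound_layer_succ_succ (κ : ZpExtension K p) {n₀ : ℕ} (hκ : TotallyRamifiedFrom κ n₀)
    [NumberField (κ.layer (n₀ + 1))] [NumberField (κ.layer (n₀ + (1 + 1)))] {c : ℕ} (hc : c ≤ p - 1)
    (hgen : letI : Algebra (κ.layer (n₀ + 1)) (κ.layer (n₀ + (1 + 1))) :=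
        (IntermediateField.inclusion (κ.layer_mono (by omega))).toRingHom.toAlgebra
      (powMonoidHom p : ClassGroup (𝓞 (κ.layer (n₀ + 1))) →* ClassGroup (𝓞 (κ.layer (n₀ + 1)))).range.index *
          (∏ᶠ v : HeightOneSpectrum (𝓞 (κ.layer (n₀ + 1))), v.asIdeal.ramificationIdxIn (𝓞 (κ.layer (n₀ + (1 + 1))))) ≤
        p ^ c * p * (unitsE (κ.layer (n₀ + (1 + 1))) ⊓ (⊤ : Subgroup (κ.layer (n₀ + (1 + 1)))ˣ).map
            (Herbrand.norm ((κ.layer (n₀ + (1 + 1))) ≃ₐ[κ.layer (n₀ + 1)] (κ.layer (n₀ + (1 + 1)))))).relIndex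
          (unitsE (κ.layer (n₀ + (1 + 1))) ⊓ (unitsIncl (κ.layer (n₀ + 1)) (κ.layer (n₀ + (1 + 1)))).range)) :
    ClassicalMuVanishes κ ∧ classicalLambda κ ≤ c :=
  classicalLambda_le_of_forall_classGroupPRank_le κ hκ le_rfl fun m hm => by
    obtain ⟨k, rfl⟩ : ∃ k, m = n₀ + k := ⟨m - n₀, by omega⟩
    exact classGroupPRank_le_of_genus_bound_layer_succ_succ κ hκ hc hgen k

/-- **Door L12 bounds `λ`: `λ ≤ c`** (rank form: `[Cl(M):Cl(M)^p] ≤ p^k`, `p^r ∣ [E_M : E_M ∩ N Lˣ]`, `k + t ≤ c + 1 + r`).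
[cite: Washington1997, §13.3 Prop. 13.23 and Thm. 13.13] [cite: Gras2003, IV.4] -/
theorem classicalLambda_le_of_rank_add_le_layer_succ_succ (κ : ZpExtension K p) {n₀ : ℕ} (hκ : TotallyRamifiedFrom κ n₀)
    [NumberField (κ.layer (n₀ + 1))] [NumberField (κ.layer (n₀ + (1 + 1)))] {c k r : ℕ} (hc : c ≤ p - 1)
    (hk : (powMonoidHom p : ClassGroup (𝓞 (κ.layer (n₀ + 1))) →* ClassGroup (𝓞 (κ.layer (n₀ + 1)))).range.index ≤ p ^ k)
    (hr : letI : Algebra (κ.layer (n₀ + 1)) (κ.layer (n₀ + (1 + 1))) :=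
        (IntermediateField.inclusion (κ.layer_mono (by omega))).toRingHom.toAlgebra
      p ^ r ∣ (unitsE (κ.layer (n₀ + (1 + 1))) ⊓ (⊤ : Subgroup (κ.layer (n₀ + (1 + 1)))ˣ).map
            (Herbrand.norm ((κ.layer (n₀ + (1 + 1))) ≃ₐ[κ.layer (n₀ + 1)] (κ.layer (n₀ + (1 + 1)))))).relIndex
          (unitsE (κ.layer (n₀ + (1 + 1))) ⊓ (unitsIncl (κ.layer (n₀ + 1)) (κ.layer (n₀ + (1 + 1)))).range))
    (ht : letI : Algebra (κ.layer (n₀ + 1)) (κ.layer (n₀ + (1 + 1))) :=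
        (IntermediateField.inclusion (κ.layer_mono (by omega))).toRingHom.toAlgebra
      k + {v : HeightOneSpectrum (𝓞 (κ.layer (n₀ + 1))) |
        v.asIdeal.ramificationIdxIn (𝓞 (κ.layer (n₀ + (1 + 1)))) ≠ 1}.ncard ≤ c + 1 + r) :
    ClassicalMuVanishes κ ∧ classicalLambda κ ≤ c :=
  classicalLambda_le_of_forall_classGroupPRank_le κ hκ le_rfl fun m hm => by
    obtain ⟨j, rfl⟩ : ∃ j, m = n₀ + j := ⟨m - n₀, by omega⟩
    exact classGroupPRank_le_of_rank_add_le_layer_succ_succ κ hκ hc hk hr ht j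

/-- **Door L10 bounds `λ`**: `TotallyRamifiedFrom κ n₀`, `n ≥ n₀`, `rank_p Cl(K_{n+j}) < p^j − 1` ⟹ `μ = 0` and **`classicalLambda κ ≤ rank_p Cl(K_{n+j})`**
(the small layer bounds every later rank, `classGroupPRank_le_of_lt_pow_sub_one`). [cite: Washington1997, §13.3 Prop. 13.22–13.23 and Thm. 13.13]
[cite: Fukuda1994, Thm. 1 (proof, p. 264)] -/
theorem classicalLambda_le_of_lt_pow_sub_one (κ : ZpExtension K p) {n₀ n : ℕ} (hκ : TotallyRamifiedFrom κ n₀) (hn : n₀ ≤ n)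
    {j : ℕ} (hsmall : classGroupPRank κ (n + j) < p ^ j - 1) :
    ClassicalMuVanishes κ ∧ classicalLambda κ ≤ classGroupPRank κ (n + j) :=
  classicalLambda_le_of_forall_classGroupPRank_le κ hκ hn fun m hm => by
    obtain ⟨k, rfl⟩ : ∃ k, m = n + k := ⟨m - n, by omega⟩
    exact classGroupPRank_le_of_lt_pow_sub_one κ hκ hn hsmall k

end Literature.NumberTheory.IwasawaTheory

end
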